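import Mathlib

/-!
# `SnSubsetDichotomy.HyperoctahedralThreshold` — stub `stub_cycleGadget`

The cycle gadget of line `refutation-local-symmetry` (crux `stmt-MatrixMultiplication-10883`,
registered stub `stub_cycleGadget` of the lead's skeleton for that line).

Data: three involutions `μ 0, μ 1, μ 2` of `Fin n` and a clean cycle of the rung graph: `k + 2`
rungs `{p i, q i}` indexed cyclically by `Fin (k + 2)`, all `2 (k + 2)` points distinct (`p`, `q`
injective with disjoint images), the colour `col i` mapping rung `i` onto rung `i + 1` on both
ends (`μ (col i) (p i) = p (i + 1)`, `μ (col i) (q i) = q (i + 1)`), consecutive colours distinct.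
Claim: a commuting local triple supported on these points, i.e. commuting involutions `a, b`, not
both trivial, with `a ∈ C(μ 0)`, `b ∈ C(μ 1)`, `a * b ∈ C(μ 2)`, moving only points `p i, q i`.

Proof.  Rung `i` *sees* the two distinct colours `col (i - 1)` and `col i`.  For a colour `c` let
`σ c` be the product of the transpositions `(p i  q i)` over the rungs `i` seeing `c`.  We realise
`σ c` as the image under `Equiv.Perm.viaEmbeddingHom` (along the embedding `Sum.elim p q` of the
abstract rung space `Fin (k + 2) ⊕ Fin (k + 2)`) of the *rung flip* exchanging `inl i` and `inr i`
exactly when rung `i` sees `c`; so `σ c` is an involution, the `σ c` commute, and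
`σ 0 * σ 1 = σ 2` because every rung sees exactly two of the three colours
(`CycleGadget.flip_mul_flip`).  `σ c` commutes with `μ c` (`CycleGadget.viaEmbedding_flip_comm`):
if rung `i` sees `c` then `μ c` carries `p i ↦ p j`, `q i ↦ q j` for a rung `j` seeing `c`
(`j = i + 1` if `col i = c`, `j = i - 1` if `col (i - 1) = c`, using `μ c * μ c = 1`), so both
`σ c ∘ μ c` and `μ c ∘ σ c` send `p i ↦ q j`, `q i ↦ p j`; a point outside these rungs is fixed by
`σ c` and so is its `μ c`-image (the set of such rungs' points is `μ c`-stable and `μ c` is an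
involution).  Finally rung `0` sees `0` or `1` (two distinct colours cannot both be `2`), so
`σ 0 ≠ 1` or `σ 1 ≠ 1`; take `a := σ 0`, `b := σ 1`.
-/

namespace Summit.MatrixMultiplication.MatrixMultiplication.Theorems.HyperoctahedralThreshold

open Equiv

namespace CycleGadget

/-- Two permutations commute as soon as the first fixes every point outside a set `S` which is
stable under the second, an involution, and the two commute on `S`. [folklore] -/
theorem mul_comm_of_invariant {β : Type*} (σ μ : Perm β) (S : β → Prop) (hμ : ∀ v, μ (μ v) = v)
    (h1 : ∀ v, ¬S v → σ v = v) (h2 : ∀ v, S v → S (μ v)) (h3 : ∀ v, S v → σ (μ v) = μ (σ v)) :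
    σ * μ = μ * σ := by
  refine Equiv.ext fun v => ?_
  simp only [Perm.mul_apply]
  by_cases hv : S v
  · exact h3 v hv
  · have hμv : ¬S (μ v) := fun h => by
      have h' := h2 _ h
      rw [hμ] at h'
      exact hv h'
    rw [h1 v hv, h1 _ hμv]

/-- The rung flips: for predicates `J c` on `ι` there are permutations of `ι ⊕ ι` exchanging
`inl i` and `inr i` exactly when `J c i` and fixing everything else. [folklore] -/
theorem exists_flip {κ ι : Type*} (J : κ → ι → Prop) [∀ c, DecidablePred (J c)] :
    ∃ τ : κ → Perm (ι ⊕ ι), ∀ c,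
      (∀ i, τ c (Sum.inl i) = if J c i then Sum.inr i else Sum.inl i) ∧
      (∀ i, τ c (Sum.inr i) = if J c i then Sum.inl i else Sum.inr i) := by
  refine ⟨fun c => Function.Involutive.toPerm
    (Sum.elim (fun i => if J c i then Sum.inr i else Sum.inl i)
      (fun i => if J c i then Sum.inl i else Sum.inr i)) ?_, fun c => ⟨fun i => rfl, fun i => rfl⟩⟩
  rintro (i | i) <;> by_cases h : J c i <;> simp [h]

/-- A rung flip is an involution. [folklore] -/
theorem flip_mul_self {ι : Type*} {J : ι → Prop} [DecidablePred J] {τ : Perm (ι ⊕ ι)}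
    (hl : ∀ i, τ (Sum.inl i) = if J i then Sum.inr i else Sum.inl i)
    (hr : ∀ i, τ (Sum.inr i) = if J i then Sum.inl i else Sum.inr i) : τ * τ = 1 := by
  refine Equiv.ext ?_
  rintro (i | i) <;> by_cases h : J i <;> simp [Perm.mul_apply, hl, hr, h]

/-- The product of the rung flips along `J` and `J'` is the rung flip along their symmetric
difference `J''`. [folklore] -/
theorem flip_mul_flip {ι : Type*} {J J' J'' : ι → Prop} [DecidablePred J] [DecidablePred J']
    [DecidablePred J''] {τ τ' τ'' : Perm (ι ⊕ ι)}
    (hl : ∀ i, τ (Sum.inl i) = if J i then Sum.inr i else Sum.inl i)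
    (hr : ∀ i, τ (Sum.inr i) = if J i then Sum.inl i else Sum.inr i)
    (hl' : ∀ i, τ' (Sum.inl i) = if J' i then Sum.inr i else Sum.inl i)
    (hr' : ∀ i, τ' (Sum.inr i) = if J' i then Sum.inl i else Sum.inr i)
    (hl'' : ∀ i, τ'' (Sum.inl i) = if J'' i then Sum.inr i else Sum.inl i)
    (hr'' : ∀ i, τ'' (Sum.inr i) = if J'' i then Sum.inl i else Sum.inr i)
    (hJ : ∀ i, J'' i ↔ (J i ↔ ¬J' i)) : τ * τ' = τ'' := by
  refine Equiv.ext ?_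
  rintro (i | i) <;> have hi := hJ i <;> by_cases h : J i <;> by_cases h' : J' i <;>
    simp [Perm.mul_apply, hl, hr, hl', hr', hl'', hr'', h, h', hi]

/-- A rung flip along a predicate holding at some rung is nontrivial. [folklore] -/
theorem flip_ne_one {ι : Type*} {J : ι → Prop} [DecidablePred J] {τ : Perm (ι ⊕ ι)}
    (hl : ∀ i, τ (Sum.inl i) = if J i then Sum.inr i else Sum.inl i) {i : ι} (hi : J i) :
    τ ≠ 1 := by
  intro h
  have h' := hl i
  rw [h, if_pos hi, Perm.one_apply] at h'
  exact Sum.inl_ne_inr h'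

/-- The embedded rung flip along `J` (rung `i` realised as the pair `p i = e (inl i)`,
`q i = e (inr i)`) commutes with an involution `μ` carrying every rung of `J` onto a rung of `J`,
both ends alike. [folklore] -/
theorem viaEmbedding_flip_comm {ι β : Type*} {p q : ι → β} (e : ι ⊕ ι ↪ β)
    (hp : ∀ i, e (Sum.inl i) = p i) (hq : ∀ i, e (Sum.inr i) = q i)
    {J : ι → Prop} [DecidablePred J] {τ : Perm (ι ⊕ ι)}
    (hl : ∀ i, τ (Sum.inl i) = if J i then Sum.inr i else Sum.inl i)
    (hr : ∀ i, τ (Sum.inr i) = if J i then Sum.inl i else Sum.inr i)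
    (μ : Perm β) (hμ : ∀ v, μ (μ v) = v)
    (hnext : ∀ i, J i → ∃ j, J j ∧ μ (p i) = p j ∧ μ (q i) = q j) :
    Perm.viaEmbeddingHom e τ * μ = μ * Perm.viaEmbeddingHom e τ := by
  rw [Perm.viaEmbeddingHom_apply]
  -- evaluation of the embedded flip on the rungs
  have ep : ∀ i, J i → τ.viaEmbedding e (p i) = q i := fun i hi => by
    rw [← hp, Perm.viaEmbedding_apply, hl, if_pos hi, hq]
  have eq : ∀ i, J i → τ.viaEmbedding e (q i) = p i := fun i hi => by
    rw [← hq, Perm.viaEmbedding_apply, hr, if_pos hi, hp]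
  refine mul_comm_of_invariant _ μ (fun v => ∃ i, J i ∧ (v = p i ∨ v = q i)) hμ ?_ ?_ ?_
  · -- points off the rungs of `J` are fixed
    intro v hv
    by_cases hmem : v ∈ Set.range e
    · obtain ⟨x, rfl⟩ := hmem
      rcases x with i | i
      · have hJ : ¬J i := fun h => hv ⟨i, h, Or.inl (hp i)⟩
        rw [Perm.viaEmbedding_apply, hl, if_neg hJ]
      · have hJ : ¬J i := fun h => hv ⟨i, h, Or.inr (hq i)⟩
        rw [Perm.viaEmbedding_apply, hr, if_neg hJ]
    · exact Perm.viaEmbedding_apply_of_notMem _ _ _ hmem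
  · -- the rungs of `J` are `μ`-stable
    rintro v ⟨i, hi, rfl | rfl⟩
    · obtain ⟨j, hj, hpj, -⟩ := hnext i hi
      exact ⟨j, hj, Or.inl hpj⟩
    · obtain ⟨j, hj, -, hqj⟩ := hnext i hi
      exact ⟨j, hj, Or.inr hqj⟩
  · -- on the rungs of `J` the two maps commute
    rintro v ⟨i, hi, rfl | rfl⟩
    · obtain ⟨j, hj, hpj, hqj⟩ := hnext i hi
      rw [hpj, ep j hj, ep i hi, hqj]
    · obtain ⟨j, hj, hpj, hqj⟩ := hnext i hi
      rw [hqj, eq j hj, eq i hi, hpj]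

/-- Of two distinct colours in `Fin 3`, `2` occurs iff exactly one of `0`, `1` occurs.
[folklore] -/
theorem fin3_two_iff : ∀ x y : Fin 3, y ≠ x →
    ((x = 2 ∨ y = 2) ↔ ((x = 0 ∨ y = 0) ↔ ¬(x = 1 ∨ y = 1))) := by
  decide

/-- Two distinct colours in `Fin 3` comprise `0` or `1`. [folklore] -/
theorem fin3_zero_or_one : ∀ x y : Fin 3, y ≠ x → (x = 0 ∨ y = 0) ∨ (x = 1 ∨ y = 1) := by
  decide

end CycleGadget

open CycleGadget in
/-- **Stub `stub_cycleGadget` — the cycle gadget** (line `refutation-local-symmetry` of crux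
`SnSubsetDichotomy.HyperoctahedralThreshold`, stmt-MatrixMultiplication-10883).  A clean cycle of
`k + 2` rungs `{p i, q i}` for three involutions `μ 0, μ 1, μ 2` of `Fin n` (colour `col i` maps
rung `i` onto rung `i + 1`, consecutive colours distinct) carries a commuting local triple:
commuting involutions `a ∈ C(μ 0)`, `b ∈ C(μ 1)`, not both trivial, with `a * b ∈ C(μ 2)`,
supported on the rungs (`a`, `b` are the products of the rung transpositions `(p i  q i)` over the
rungs seeing colour `0`, resp. `1`; `CycleGadget.viaEmbedding_flip_comm`,
`CycleGadget.flip_mul_flip`). [folklore] -/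
theorem stub_cycleGadget : ∀ (n k : ℕ) (μ : Fin 3 → Equiv.Perm (Fin n)) (p q : Fin (k + 2) → Fin n) (col : Fin (k + 2) → Fin 3), (∀ c, μ c * μ c = 1) → Function.Injective p → Function.Injective q → (∀ i j, p i ≠ q j) → (∀ i, μ (col i) (p i) = p (i + 1) ∧ μ (col i) (q i) = q (i + 1)) → (∀ i, col i ≠ col (i + 1)) → ∃ a b : Equiv.Perm (Fin n), a * a = 1 ∧ b * b = 1 ∧ a * b = b * a ∧ (a ≠ 1 ∨ b ≠ 1) ∧ a * μ 0 = μ 0 * a ∧ b * μ 1 = μ 1 * b ∧ a * b * μ 2 = μ 2 * (a * b) ∧ (∀ v, (a v ≠ v ∨ b v ≠ v) → ∃ i, v = p i ∨ v = q i) := by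
  intro n k μ p q col hμ hp hq hpq hstep hcol
  classical
  -- the `μ c` are involutions, pointwise
  have hμ' : ∀ c v, μ c (μ c v) = v := fun c v => by
    rw [← Perm.mul_apply, hμ c, Perm.one_apply]
  -- rung `i` sees the distinct colours `col (i - 1)` and `col i`
  have hsee : ∀ i : Fin (k + 2), col (i - 1) ≠ col i := fun i => by
    have h := hcol (i - 1)
    rwa [sub_add_cancel] at h
  have hI2 : ∀ i : Fin (k + 2), (col i = 2 ∨ col (i - 1) = 2) ↔
      ((col i = 0 ∨ col (i - 1) = 0) ↔ ¬(col i = 1 ∨ col (i - 1) = 1)) := fun i =>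
    fin3_two_iff (col i) (col (i - 1)) (hsee i)
  have h01 : (col 0 = 0 ∨ col (0 - 1) = 0) ∨ (col 0 = 1 ∨ col (0 - 1) = 1) :=
    fin3_zero_or_one (col 0) (col (0 - 1)) (hsee 0)
  -- dynamics: colour `c` carries a rung seeing `c` onto a rung seeing `c`, both ends alike
  have hnext : ∀ (c : Fin 3) (i : Fin (k + 2)), (col i = c ∨ col (i - 1) = c) →
      ∃ j, (col j = c ∨ col (j - 1) = c) ∧ μ c (p i) = p j ∧ μ c (q i) = q j := by
    rintro c i (h | h)
    · refine ⟨i + 1, Or.inr (by rwa [add_sub_cancel_right]), ?_, ?_⟩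
      · rw [← h]
        exact (hstep i).1
      · rw [← h]
        exact (hstep i).2
    · have h1 := (hstep (i - 1)).1
      have h2 := (hstep (i - 1)).2
      rw [sub_add_cancel, h] at h1 h2
      exact ⟨i - 1, Or.inl h, by rw [← h1, hμ'], by rw [← h2, hμ']⟩
  -- the rung flips along the rungs seeing `c`, and the embedding of the abstract rung space
  obtain ⟨τ, hτ⟩ :=
    exists_flip fun (c : Fin 3) (i : Fin (k + 2)) => col i = c ∨ col (i - 1) = c
  obtain ⟨e, hep, heq⟩ : ∃ e : Fin (k + 2) ⊕ Fin (k + 2) ↪ Fin n,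
      (∀ i, e (Sum.inl i) = p i) ∧ (∀ i, e (Sum.inr i) = q i) :=
    ⟨⟨Sum.elim p q, hp.sumElim hq hpq⟩, fun i => rfl, fun i => rfl⟩
  have hcomm : ∀ c, Perm.viaEmbeddingHom e (τ c) * μ c = μ c * Perm.viaEmbeddingHom e (τ c) :=
    fun c => viaEmbedding_flip_comm e hep heq (hτ c).1 (hτ c).2 (μ c) (hμ' c) (hnext c)
  have h01eq : τ 0 * τ 1 = τ 2 :=
    flip_mul_flip (hτ 0).1 (hτ 0).2 (hτ 1).1 (hτ 1).2 (hτ 2).1 (hτ 2).2 hI2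
  have h10eq : τ 1 * τ 0 = τ 2 :=
    flip_mul_flip (hτ 1).1 (hτ 1).2 (hτ 0).1 (hτ 0).2 (hτ 2).1 (hτ 2).2
      fun i => (hI2 i).trans iff_not_comm
  refine ⟨Perm.viaEmbeddingHom e (τ 0), Perm.viaEmbeddingHom e (τ 1), ?_, ?_, ?_, ?_, hcomm 0,
    hcomm 1, ?_, ?_⟩
  · rw [← map_mul, flip_mul_self (hτ 0).1 (hτ 0).2, map_one]
  · rw [← map_mul, flip_mul_self (hτ 1).1 (hτ 1).2, map_one]
  · rw [← map_mul, ← map_mul, h01eq, h10eq]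
  · rcases h01 with h | h
    · exact Or.inl fun h1 => flip_ne_one (hτ 0).1 h
        (Perm.viaEmbeddingHom_injective e (h1.trans (map_one _).symm))
    · exact Or.inr fun h1 => flip_ne_one (hτ 1).1 h
        (Perm.viaEmbeddingHom_injective e (h1.trans (map_one _).symm))
  · rw [← map_mul, h01eq]
    exact hcomm 2
  · intro v hv
    by_contra hne
    have hmem : v ∉ Set.range e := by
      rintro ⟨x, rfl⟩
      rcases x with i | i
      · exact hne ⟨i, Or.inl (hep i)⟩
      · exact hne ⟨i, Or.inr (heq i)⟩
    simp only [Perm.viaEmbeddingHom_apply, Perm.viaEmbedding_apply_of_notMem _ _ _ hmem] at hv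
    simp at hv

end Summit.MatrixMultiplication.MatrixMultiplication.Theorems.HyperoctahedralThreshold
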